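import Summits.AtomisticToContinuum.BoseEinsteinCondensation.Theses.BECStoquasticCensoring

/-!
# Birth skeleton (BC3) for crux `BECStoquasticCensoring.CensoredTransfer`
(stmt-AtomisticToContinuum-14713 · route route-AtomisticToContinuum-BECStoquasticCensoring · skeleton-register, gen 1)

Crux (BY NAME, never restated):
`CensoredTransfer := VillainCurrentLRO → CellCountTailsU → CountViolationGapU → CellCondensationGrowing → ZeroModeOccupation`.

The skeleton cuts the crux along the two seams its own docstring names:

* **(o) free branch** — `stub_freeGasZeroMode : FreeGasZeroMode` (the route's support item stmt-AtomisticToContinuum-8912,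
  by name): `v` a.e. zero on `(0,∞)` ⇒ free Dirichlet gas ⇒ `⟨φ₀, γ_Ψ φ₀⟩ ≥ N/4` for near-minimisers.
* **(i)–(iv) up to block coherence: THE BET** — `stub_censoredBlockCoherence`: for a genuinely interacting `v`
  (not a.e. zero), the engine `VillainCurrentLRO`, the two K-uniform censoring inputs and log-mesoscale local
  condensation give INTERIOR BLOCK COHERENCE of every `δ`-near-minimiser: at some mesoscale `0 < ℓ ≤ L / log N`
  (the transfer's `ℓ(N) = K(N)(ρa)^{-1/2}`, `K(N) ≍ (log N)^{1/3}`), for EVERY pair of interior lattice cells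
  `Q = ℓ(n+1) + [0,ℓ)³`, `Q' = ℓ(n'+1) + [0,ℓ)³` (`(nₖ+3)ℓ ≤ L`), `Re⟨1_Q, γ_Ψ 1_{Q'}⟩ ≥ c ρ ℓ⁶`, written by
  polarisation through the route's `occupation` functional: `4cρℓ⁶ + occ(1_Q − 1_{Q'}) ≤ occ(1_Q + 1_{Q'})`
  (`occ(g₊) − occ(g₋) = 4 Re⟨1_Q, γ 1_{Q'}⟩`; the diagonal `n = n'` is cell condensation at scale `ℓ`). This stub
  carries the whole censoring mechanism (Doob transform + trace form on the window set, positive coarse current law,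
  engine ⇒ equal-time worm LRO ⇒ block coherence of `Ψ₀`, compactness transfer to near-minimisers at fixed `(N, L)`).
* **(iv) endgame, one-body analysis** — `stub_blockToZeroMode`: interior block coherence at any scale `ℓ` with
  `ℓ log N ≤ L` ⇒ `⟨φ₀, γ_Ψ φ₀⟩ ≥ (c/4)N`: `φ₀ = L^{-3/2}(Σ_Q 1_Q + 1_strip)`, `occ` is `N‖T·‖²` for the conjugate-linear
  `Tφ = ∫ conj φ Ψ`, so `⟨φ₀,γφ₀⟩ ≥ (√(cN(1−3ℓ/L)⁶) − √(9ℓN/L))²` (pair sum over `m³ ≥ (L/ℓ−3)³` cells; strip mass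
  `≤ N‖1_strip‖²/L³ ≤ 9ℓN/L` by Cauchy–Schwarz) `≥ (c/4)N` once `ℓ/L ≤ 1/log N` is small. Provable now (M/L).

Composition: `censoredTransfer_of_parts : sig₁ → sig₂ → sig₃ → (VillainCurrentLRO → CellCountTailsU → CountViolationGapU →
CellCondensationGrowing → ZeroModeOccupation)` is a real proof (case split on the a.e.-zero branch, `c ↦ c/4`), and
`CensoredTransfer_of : CensoredTransfer` (the crux BY NAME) applies it to the three stubs; `sorry` occurs only inside
the three `stub_*` declarations.

Disproof used: none — `ledger crux ls stmt-AtomisticToContinuum-14713` shows no `Disproof.lean` / Negative lemmas for this crux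
(2026-08-17). Negatives index entries of the route (BECSwapAffinity.SwapJensen, BECPopovBerryRG.BerryStiffPhaseLRO) concern an
n-dependent Villain sandwich, not block coherence / zero-mode geometry.

Stub signatures are SELF-CONTAINED (Literature and route declarations fully qualified, no `let … :=`).
-/

namespace Summit.AtomisticToContinuum.BoseEinsteinCondensation.Cruxes.CensoredTransfer.Birth

open MeasureTheory Filter
open scoped ENNReal

/-! ## The three registered stubs -/

/-- **Stub (o) `stub_freeGasZeroMode` — the free branch (= route support item `FreeGasZeroMode`, stmt-AtomisticToContinuum-8912,
BY NAME).** For `v` a.e. zero on `(0,∞)` the interaction vanishes a.e. on configuration space, the gas is the free Dirichlet gas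
(`E₀ = 3Nπ²/L²`, gap `3π²/L²`), and a `δ`-near-minimiser with `δ ≤ η²·3π²/L²` is `η`-close to `χ^{⊗N}`, `χ = ∏ (2/L)^{1/2} sin(πx_j/L)`,
whence `⟨φ₀, γ_Ψ φ₀⟩ ≥ ((8/π²)³ − O(η))N ≥ N/4`. Size M (sharp 1-D Poincaré, tensorisation, explicit sine integrals). [LSSY2005] -/
theorem stub_freeGasZeroMode :
    Summit.AtomisticToContinuum.BoseEinsteinCondensation.Theses.BECStoquasticCensoring.FreeGasZeroMode := by
  sorry

/-- **Stub (iv-b) `stub_blockToZeroMode` — INTERIOR BLOCK COHERENCE ⇒ ZERO-MODE OCCUPATION (one-body analysis, provable now, M/L).**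
For any `v`, density `ρ > 0` and `c > 0`: if for all large `N` there are `δ > 0` and a cell side `0 < ℓ` with `ℓ·log N ≤ L`
(`L = (N/ρ)^{1/3}`) such that every `δ`-near-minimiser `Ψ` of the Dirichlet energy has, for every pair of interior lattice cells
`Q = ℓ(n+1) + [0,ℓ)³`, `Q' = ℓ(n'+1) + [0,ℓ)³` with `(nₖ+3)ℓ ≤ L`, the polarised pair coherence
`4cρℓ⁶ + occ(1_Q − 1_{Q'}) ≤ occ(1_Q + 1_{Q'})` (i.e. `Re⟨1_Q, γ_Ψ 1_{Q'}⟩ ≥ cρℓ⁶`), then for all large `N` the same `δ` gives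
`⟨φ₀, γ_Ψ φ₀⟩ ≥ (c/4)·N` for the normalised flat mode `φ₀ = L^{-3/2}·1_box`. Proof route: `occupation N φ Ψ = N·‖Tφ‖²` with
`(Tφ)(Y) = ∫ conj φ(x) Ψ(x,Y) dx` conjugate-linear and `‖Tφ‖ ≤ ‖φ‖₂` (Cauchy–Schwarz, `‖Ψ‖ = 1`); `1_box = Σ_Q 1_Q + 1_strip` a.e. with
`m = ⌊L/ℓ⌋ − 2 ≥ L/ℓ − 3` cells per axis; `N‖T Σ_Q 1_Q‖² = Σ_{Q,Q'} N·Re⟨T1_Q, T1_{Q'}⟩ ≥ m⁶cρℓ⁶ ≥ cρL⁶(1 − 3ℓ/L)⁶ = cNL³(1−3ℓ/L)⁶`,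
`N‖T1_strip‖² ≤ N·|strip| ≤ 9ℓL²N`; so `⟨φ₀,γφ₀⟩ ≥ N(√(c(1−3ℓ/L)⁶) − √(9ℓ/L))² ≥ (c/4)N` once `ℓ/L ≤ 1/log N` is small enough. -/
theorem stub_blockToZeroMode :
    ∀ (v : ℝ → ℝ≥0∞) (ρ c : ℝ), 0 < ρ → 0 < c →
    (∀ᶠ N : ℕ in Filter.atTop, ∃ δ : ℝ≥0∞, 0 < δ ∧ ∃ ℓ : ℝ, 0 < ℓ ∧
      ℓ * Real.log N ≤ Literature.MathematicalPhysics.QuantumManyBody.BoseGas.sideLength ρ N ∧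
      ∀ Ψ : Literature.MathematicalPhysics.QuantumManyBody.BoseGas.TrialState N
        (Literature.MathematicalPhysics.QuantumManyBody.BoseGas.sideLength ρ N),
      Literature.MathematicalPhysics.QuantumManyBody.BoseGas.energy v Ψ ≤
        Literature.MathematicalPhysics.QuantumManyBody.BoseGas.groundStateEnergy v N
          (Literature.MathematicalPhysics.QuantumManyBody.BoseGas.sideLength ρ N) + δ →
      ∀ n n' : Fin 3 → ℕ,
      (∀ k, ((n k : ℝ) + 3) * ℓ ≤ Literature.MathematicalPhysics.QuantumManyBody.BoseGas.sideLength ρ N) →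
      (∀ k, ((n' k : ℝ) + 3) * ℓ ≤ Literature.MathematicalPhysics.QuantumManyBody.BoseGas.sideLength ρ N) →
      ENNReal.ofReal (4 * c * ρ * ℓ ^ 6) +
        Literature.MathematicalPhysics.QuantumManyBody.BoseGas.occupation N
          (fun x => ({y : EuclideanSpace ℝ (Fin 3) | ∀ k, y k ∈ Set.Ico (((n k : ℝ) + 1) * ℓ) (((n k : ℝ) + 1) * ℓ + ℓ)}).indicator (fun _ => (1 : ℂ)) x
            - ({y : EuclideanSpace ℝ (Fin 3) | ∀ k, y k ∈ Set.Ico (((n' k : ℝ) + 1) * ℓ) (((n' k : ℝ) + 1) * ℓ + ℓ)}).indicator (fun _ => (1 : ℂ)) x) Ψ.ψ ≤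
        Literature.MathematicalPhysics.QuantumManyBody.BoseGas.occupation N
          (fun x => ({y : EuclideanSpace ℝ (Fin 3) | ∀ k, y k ∈ Set.Ico (((n k : ℝ) + 1) * ℓ) (((n k : ℝ) + 1) * ℓ + ℓ)}).indicator (fun _ => (1 : ℂ)) x
            + ({y : EuclideanSpace ℝ (Fin 3) | ∀ k, y k ∈ Set.Ico (((n' k : ℝ) + 1) * ℓ) (((n' k : ℝ) + 1) * ℓ + ℓ)}).indicator (fun _ => (1 : ℂ)) x) Ψ.ψ) →
    ∀ᶠ N : ℕ in Filter.atTop, ∃ δ : ℝ≥0∞, 0 < δ ∧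
      ∀ Ψ : Literature.MathematicalPhysics.QuantumManyBody.BoseGas.TrialState N
        (Literature.MathematicalPhysics.QuantumManyBody.BoseGas.sideLength ρ N),
      Literature.MathematicalPhysics.QuantumManyBody.BoseGas.energy v Ψ ≤
        Literature.MathematicalPhysics.QuantumManyBody.BoseGas.groundStateEnergy v N
          (Literature.MathematicalPhysics.QuantumManyBody.BoseGas.sideLength ρ N) + δ →
      ENNReal.ofReal (c / 4 * N) ≤
        Literature.MathematicalPhysics.QuantumManyBody.BoseGas.occupation N
          ((Literature.MathematicalPhysics.QuantumManyBody.BoseGas.box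
            (Literature.MathematicalPhysics.QuantumManyBody.BoseGas.sideLength ρ N)).indicator fun _ =>
              ((Real.sqrt (Literature.MathematicalPhysics.QuantumManyBody.BoseGas.sideLength ρ N ^ 3))⁻¹ : ℂ)) Ψ.ψ := by
  sorry

/-- **Stub (i)–(iv-a) `stub_censoredBlockCoherence` — THE BET: censoring inputs + engine ⇒ interior block coherence of
near-minimisers at a logarithmic mesoscale.** For a repulsive finite-range `v` that is NOT a.e. zero on `(0,∞)` (so
`a = scatteringLength v ∈ (0,∞)`, support `ScatteringLengthPos`, proved): the engine `VillainCurrentLRO`, the K-uniform censoring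
inputs `CellCountTailsU`, `CountViolationGapU` and log-mesoscale local condensation `CellCondensationGrowing` give `ρ₀ > 0` and, for
`0 < ρ < ρ₀`, a constant `c > 0` such that for all large `N` some `δ > 0` and some cell side `0 < ℓ ≤ L/log N` (intended:
`ℓ = ℓ(N) = K(N)(ρa)^{-1/2}`, `K(N) = max(K₀, ((2/c₁)(ρa³)^{1/2} log N)^{1/3}) ≤ log N`, and `ℓ(N) log N ≤ (log N)²(ρa)^{-1/2} ≤ L`
eventually) make every `δ`-near-minimiser block-coherent across ALL pairs of interior lattice cells:
`Re⟨1_Q, γ_Ψ 1_{Q'}⟩ ≥ cρℓ⁶` in the polarised `occupation` form. Mechanism (route header): Doob-transform the nonnegative ground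
state, censor (trace) its diffusion onto the all-cells window set `P` (`π(P) ≥ 1 − C/N` by `CellCountTailsU` + union bound;
positivity/exactness by `StoquasticSchurComplement`), exits rare and short (`CountViolationGapU`) ⇒ quasi-local positive jump
kernel (K1), push forward to a positive (3+1)-D current law = Villain at stiffness `≍ K(N)²(ρa³)^{-1/2}` with Λ-bounded
inhomogeneity (`CellCondensationGrowing`), engine ⇒ equal-time worm LRO ⇒ block coherence of `Ψ₀` ⇒ (compactness / ground-state
nondegeneracy at fixed `(N, L)`) of all `δ`-near-minimisers. Size: open-problem (it is the crux's content minus the free branch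
and the one-body endgame). Why it might fail: K1 (re-entry need not split into cell-local positive jumps) and the engine class
(free boundary, N-dependent stiffness, quasi-local factors with memory) — exactly the crux's recorded why-might-fail. -/
theorem stub_censoredBlockCoherence :
    Summit.AtomisticToContinuum.BoseEinsteinCondensation.Theses.BECStoquasticCensoring.VillainCurrentLRO →
    Summit.AtomisticToContinuum.BoseEinsteinCondensation.Theses.BECStoquasticCensoring.CellCountTailsU →
    Summit.AtomisticToContinuum.BoseEinsteinCondensation.Theses.BECStoquasticCensoring.CountViolationGapU →
    Summit.AtomisticToContinuum.BoseEinsteinCondensation.Theses.BECStoquasticCensoring.CellCondensationGrowing →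
    ∀ v : ℝ → ℝ≥0∞, Literature.MathematicalPhysics.QuantumManyBody.BoseGas.IsRepulsiveFiniteRange v →
    ¬ (∀ᵐ r ∂(MeasureTheory.volume.restrict (Set.Ioi (0 : ℝ))), v r = 0) →
    ∃ ρ₀ : ℝ, 0 < ρ₀ ∧ ∀ ρ : ℝ, 0 < ρ → ρ < ρ₀ → ∃ c : ℝ, 0 < c ∧
    ∀ᶠ N : ℕ in Filter.atTop, ∃ δ : ℝ≥0∞, 0 < δ ∧ ∃ ℓ : ℝ, 0 < ℓ ∧
      ℓ * Real.log N ≤ Literature.MathematicalPhysics.QuantumManyBody.BoseGas.sideLength ρ N ∧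
      ∀ Ψ : Literature.MathematicalPhysics.QuantumManyBody.BoseGas.TrialState N
        (Literature.MathematicalPhysics.QuantumManyBody.BoseGas.sideLength ρ N),
      Literature.MathematicalPhysics.QuantumManyBody.BoseGas.energy v Ψ ≤
        Literature.MathematicalPhysics.QuantumManyBody.BoseGas.groundStateEnergy v N
          (Literature.MathematicalPhysics.QuantumManyBody.BoseGas.sideLength ρ N) + δ →
      ∀ n n' : Fin 3 → ℕ,
      (∀ k, ((n k : ℝ) + 3) * ℓ ≤ Literature.MathematicalPhysics.QuantumManyBody.BoseGas.sideLength ρ N) →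
      (∀ k, ((n' k : ℝ) + 3) * ℓ ≤ Literature.MathematicalPhysics.QuantumManyBody.BoseGas.sideLength ρ N) →
      ENNReal.ofReal (4 * c * ρ * ℓ ^ 6) +
        Literature.MathematicalPhysics.QuantumManyBody.BoseGas.occupation N
          (fun x => ({y : EuclideanSpace ℝ (Fin 3) | ∀ k, y k ∈ Set.Ico (((n k : ℝ) + 1) * ℓ) (((n k : ℝ) + 1) * ℓ + ℓ)}).indicator (fun _ => (1 : ℂ)) x
            - ({y : EuclideanSpace ℝ (Fin 3) | ∀ k, y k ∈ Set.Ico (((n' k : ℝ) + 1) * ℓ) (((n' k : ℝ) + 1) * ℓ + ℓ)}).indicator (fun _ => (1 : ℂ)) x) Ψ.ψ ≤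
        Literature.MathematicalPhysics.QuantumManyBody.BoseGas.occupation N
          (fun x => ({y : EuclideanSpace ℝ (Fin 3) | ∀ k, y k ∈ Set.Ico (((n k : ℝ) + 1) * ℓ) (((n k : ℝ) + 1) * ℓ + ℓ)}).indicator (fun _ => (1 : ℂ)) x
            + ({y : EuclideanSpace ℝ (Fin 3) | ∀ k, y k ∈ Set.Ico (((n' k : ℝ) + 1) * ℓ) (((n' k : ℝ) + 1) * ℓ + ℓ)}).indicator (fun _ => (1 : ℂ)) x) Ψ.ψ := by
  sorry

/-! ## Composition (real proofs, no `sorry` below this line) -/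

/-- **Composition, implication form** (`<stub sigs> → CensoredTransfer` with the crux body spelled out so that exactly one
theorem of this file, `CensoredTransfer_of`, concludes the crux BY NAME): the free branch, the bet and the one-body endgame
give `VillainCurrentLRO → CellCountTailsU → CountViolationGapU → CellCondensationGrowing → ZeroModeOccupation`.
Logic: case split on whether `v` is a.e. zero on `(0,∞)`; in the interacting branch take the bet's `ρ₀`, its `c`, and
`c/4` as the zero-mode constant. -/
theorem censoredTransfer_of_parts
    (hFree : Summit.AtomisticToContinuum.BoseEinsteinCondensation.Theses.BECStoquasticCensoring.FreeGasZeroMode)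
    (hBet : Summit.AtomisticToContinuum.BoseEinsteinCondensation.Theses.BECStoquasticCensoring.VillainCurrentLRO →
      Summit.AtomisticToContinuum.BoseEinsteinCondensation.Theses.BECStoquasticCensoring.CellCountTailsU →
      Summit.AtomisticToContinuum.BoseEinsteinCondensation.Theses.BECStoquasticCensoring.CountViolationGapU →
      Summit.AtomisticToContinuum.BoseEinsteinCondensation.Theses.BECStoquasticCensoring.CellCondensationGrowing →
      ∀ v : ℝ → ℝ≥0∞, Literature.MathematicalPhysics.QuantumManyBody.BoseGas.IsRepulsiveFiniteRange v →
      ¬ (∀ᵐ r ∂(MeasureTheory.volume.restrict (Set.Ioi (0 : ℝ))), v r = 0) →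
      ∃ ρ₀ : ℝ, 0 < ρ₀ ∧ ∀ ρ : ℝ, 0 < ρ → ρ < ρ₀ → ∃ c : ℝ, 0 < c ∧
      ∀ᶠ N : ℕ in Filter.atTop, ∃ δ : ℝ≥0∞, 0 < δ ∧ ∃ ℓ : ℝ, 0 < ℓ ∧
        ℓ * Real.log N ≤ Literature.MathematicalPhysics.QuantumManyBody.BoseGas.sideLength ρ N ∧
        ∀ Ψ : Literature.MathematicalPhysics.QuantumManyBody.BoseGas.TrialState N
          (Literature.MathematicalPhysics.QuantumManyBody.BoseGas.sideLength ρ N),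
        Literature.MathematicalPhysics.QuantumManyBody.BoseGas.energy v Ψ ≤
          Literature.MathematicalPhysics.QuantumManyBody.BoseGas.groundStateEnergy v N
            (Literature.MathematicalPhysics.QuantumManyBody.BoseGas.sideLength ρ N) + δ →
        ∀ n n' : Fin 3 → ℕ,
        (∀ k, ((n k : ℝ) + 3) * ℓ ≤ Literature.MathematicalPhysics.QuantumManyBody.BoseGas.sideLength ρ N) →
        (∀ k, ((n' k : ℝ) + 3) * ℓ ≤ Literature.MathematicalPhysics.QuantumManyBody.BoseGas.sideLength ρ N) →
        ENNReal.ofReal (4 * c * ρ * ℓ ^ 6) +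
          Literature.MathematicalPhysics.QuantumManyBody.BoseGas.occupation N
            (fun x => ({y : EuclideanSpace ℝ (Fin 3) | ∀ k, y k ∈ Set.Ico (((n k : ℝ) + 1) * ℓ) (((n k : ℝ) + 1) * ℓ + ℓ)}).indicator (fun _ => (1 : ℂ)) x
              - ({y : EuclideanSpace ℝ (Fin 3) | ∀ k, y k ∈ Set.Ico (((n' k : ℝ) + 1) * ℓ) (((n' k : ℝ) + 1) * ℓ + ℓ)}).indicator (fun _ => (1 : ℂ)) x) Ψ.ψ ≤
          Literature.MathematicalPhysics.QuantumManyBody.BoseGas.occupation N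
            (fun x => ({y : EuclideanSpace ℝ (Fin 3) | ∀ k, y k ∈ Set.Ico (((n k : ℝ) + 1) * ℓ) (((n k : ℝ) + 1) * ℓ + ℓ)}).indicator (fun _ => (1 : ℂ)) x
              + ({y : EuclideanSpace ℝ (Fin 3) | ∀ k, y k ∈ Set.Ico (((n' k : ℝ) + 1) * ℓ) (((n' k : ℝ) + 1) * ℓ + ℓ)}).indicator (fun _ => (1 : ℂ)) x) Ψ.ψ)
    (hEnd : ∀ (v : ℝ → ℝ≥0∞) (ρ c : ℝ), 0 < ρ → 0 < c →
      (∀ᶠ N : ℕ in Filter.atTop, ∃ δ : ℝ≥0∞, 0 < δ ∧ ∃ ℓ : ℝ, 0 < ℓ ∧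
        ℓ * Real.log N ≤ Literature.MathematicalPhysics.QuantumManyBody.BoseGas.sideLength ρ N ∧
        ∀ Ψ : Literature.MathematicalPhysics.QuantumManyBody.BoseGas.TrialState N
          (Literature.MathematicalPhysics.QuantumManyBody.BoseGas.sideLength ρ N),
        Literature.MathematicalPhysics.QuantumManyBody.BoseGas.energy v Ψ ≤
          Literature.MathematicalPhysics.QuantumManyBody.BoseGas.groundStateEnergy v N
            (Literature.MathematicalPhysics.QuantumManyBody.BoseGas.sideLength ρ N) + δ →
        ∀ n n' : Fin 3 → ℕ,
        (∀ k, ((n k : ℝ) + 3) * ℓ ≤ Literature.MathematicalPhysics.QuantumManyBody.BoseGas.sideLength ρ N) →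
        (∀ k, ((n' k : ℝ) + 3) * ℓ ≤ Literature.MathematicalPhysics.QuantumManyBody.BoseGas.sideLength ρ N) →
        ENNReal.ofReal (4 * c * ρ * ℓ ^ 6) +
          Literature.MathematicalPhysics.QuantumManyBody.BoseGas.occupation N
            (fun x => ({y : EuclideanSpace ℝ (Fin 3) | ∀ k, y k ∈ Set.Ico (((n k : ℝ) + 1) * ℓ) (((n k : ℝ) + 1) * ℓ + ℓ)}).indicator (fun _ => (1 : ℂ)) x
              - ({y : EuclideanSpace ℝ (Fin 3) | ∀ k, y k ∈ Set.Ico (((n' k : ℝ) + 1) * ℓ) (((n' k : ℝ) + 1) * ℓ + ℓ)}).indicator (fun _ => (1 : ℂ)) x) Ψ.ψ ≤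
          Literature.MathematicalPhysics.QuantumManyBody.BoseGas.occupation N
            (fun x => ({y : EuclideanSpace ℝ (Fin 3) | ∀ k, y k ∈ Set.Ico (((n k : ℝ) + 1) * ℓ) (((n k : ℝ) + 1) * ℓ + ℓ)}).indicator (fun _ => (1 : ℂ)) x
              + ({y : EuclideanSpace ℝ (Fin 3) | ∀ k, y k ∈ Set.Ico (((n' k : ℝ) + 1) * ℓ) (((n' k : ℝ) + 1) * ℓ + ℓ)}).indicator (fun _ => (1 : ℂ)) x) Ψ.ψ) →
      ∀ᶠ N : ℕ in Filter.atTop, ∃ δ : ℝ≥0∞, 0 < δ ∧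
        ∀ Ψ : Literature.MathematicalPhysics.QuantumManyBody.BoseGas.TrialState N
          (Literature.MathematicalPhysics.QuantumManyBody.BoseGas.sideLength ρ N),
        Literature.MathematicalPhysics.QuantumManyBody.BoseGas.energy v Ψ ≤
          Literature.MathematicalPhysics.QuantumManyBody.BoseGas.groundStateEnergy v N
            (Literature.MathematicalPhysics.QuantumManyBody.BoseGas.sideLength ρ N) + δ →
        ENNReal.ofReal (c / 4 * N) ≤
          Literature.MathematicalPhysics.QuantumManyBody.BoseGas.occupation N
            ((Literature.MathematicalPhysics.QuantumManyBody.BoseGas.box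
              (Literature.MathematicalPhysics.QuantumManyBody.BoseGas.sideLength ρ N)).indicator fun _ =>
                ((Real.sqrt (Literature.MathematicalPhysics.QuantumManyBody.BoseGas.sideLength ρ N ^ 3))⁻¹ : ℂ)) Ψ.ψ) :
    Summit.AtomisticToContinuum.BoseEinsteinCondensation.Theses.BECStoquasticCensoring.VillainCurrentLRO →
    Summit.AtomisticToContinuum.BoseEinsteinCondensation.Theses.BECStoquasticCensoring.CellCountTailsU →
    Summit.AtomisticToContinuum.BoseEinsteinCondensation.Theses.BECStoquasticCensoring.CountViolationGapU →
    Summit.AtomisticToContinuum.BoseEinsteinCondensation.Theses.BECStoquasticCensoring.CellCondensationGrowing →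
    Summit.AtomisticToContinuum.BoseEinsteinCondensation.Theses.BECStoquasticCensoring.ZeroModeOccupation := by
  intro hE hT hG hC v hv
  by_cases h0 : (∀ᵐ r ∂(MeasureTheory.volume.restrict (Set.Ioi (0 : ℝ))), v r = 0)
  · exact hFree v hv h0
  · obtain ⟨ρ₀, hρ₀, H⟩ := hBet hE hT hG hC v hv h0
    refine ⟨ρ₀, hρ₀, fun ρ hρ hρlt => ?_⟩
    obtain ⟨c, hc, hBC⟩ := H ρ hρ hρlt
    exact ⟨c / 4, by positivity, hEnd v ρ c hρ hc hBC⟩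

/-- **The skeleton theorem**: the three registered stubs close the crux `CensoredTransfer` BY NAME
(`sorry` only inside `stub_freeGasZeroMode`, `stub_blockToZeroMode`, `stub_censoredBlockCoherence`). -/
theorem CensoredTransfer_of :
    Summit.AtomisticToContinuum.BoseEinsteinCondensation.Theses.BECStoquasticCensoring.CensoredTransfer :=
  censoredTransfer_of_parts stub_freeGasZeroMode stub_censoredBlockCoherence stub_blockToZeroMode

end Summit.AtomisticToContinuum.BoseEinsteinCondensation.Cruxes.CensoredTransfer.Birth
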